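import Literature.Geometry.Lorentzian.FlatQuietCollarExclusion
import Literature.Geometry.Lorentzian.MetricLocality
import Literature.Geometry.Lorentzian.BackgroundChartCalculus
import Literature.Geometry.Lorentzian.Isometry
import HarnessLib

/-!
# The Kretschmann scalar `|Rm|²` of a spacetime at a point, and its chart independence

Topic `Geometry/Lorentzian`; everything PROVED except that `Kerr.kretschmannAt_spacetime` takes the
unproved NAMED FACT `Kerr.kretschmannScalar_closedForm` (`KerrKretschmannScalar.lean`) as the hypothesis
`(hQ : Kerr.kretschmannScalar_closedForm)` and is CONDITIONAL on it. Infrastructure for the service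
files of crux `GenericCensorshipCollarMargin` (stmt-FinalStateConjecture-10809, summit
`FinalStateConjecture`; `FlatQuietCollarExclusion.lean`, `WindowedCollarCurvatureTracking.lean`):
a curvature invariant of a `Spacetime` usable as a chart-free hypothesis.

## Contents

* Part E (`MetricCoord`, coordinate level; Topping 2006 (3.2.4), O'Neill 1983 Ch. 3):
  `abs_trace_comp_sub_le`, `abs_coord_apply_coordCLM_le`, `abs_ginv_sub_ginv_le` and the
  **Lipschitz dependence of `|Rm|²` on `(g⁻¹, R)`** in an orthonormal basis, `abs_rmNormSqAt_sub_le`;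
  the jet bound `IsMetricOn.norm_riemAt_apply_le_of_jets` (`‖R(X,Y)Z‖ ≤ 11N⁴‖X‖‖Y‖‖Z‖` from
  `‖♯‖, ‖DG‖, ‖D²G‖ ≤ N`); germ invariance `rmNormSqAt_congr_metric`; and
  `isInvertible_fderiv_of_isInvertible_pullMetric` (nondegenerate `θ^* G` forces `Dθ` invertible).
* Part F (`Spacetime`, manifold level): **`kretschmannAt 𝓢 p`** — `rmNormSqAt` of the components
  `(c⁻¹)^* g` in the preferred chart `c = chartAt E4 p`, at `c p`;
  `metricInCoords_chartAt_symm_nondegenerate`, `isMetricOn_metricInCoords_chartAt_symm` (the chart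
  components are metric components on the chart target); **chart independence**
  `rmNormSqAt_metricInCoords_eq_kretschmannAt`: for every parametrisation `ψ : E4 → 𝓢` smooth on an
  open `O ∋ y` with nondegenerate components at `y`, `|Rm|²_{ψ^* g}(y) = kretschmannAt 𝓢 (ψ y)`
  (near `y`, `ψ^* g = θ^*[(c⁻¹)^* g]` for the change of coordinates `θ = c ∘ ψ`, a local
  diffeomorphism because nondegenerate components force `Dθ` invertible, O'Neill 1983 Ch. 3 p. 90;
  then naturality `rmNormSqAt_pullMetric`, O'Neill 1983 Ch. 3 Prop. 3.59); **isometry invariance**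
  `kretschmannAt_comp_of_isIsometricImmersion` (`kretschmannAt 𝓢 (E x) = kretschmannAt 𝓤 x` for an
  isometric immersion `E : 𝓤 → 𝓢`, e.g. the embedding of a Cauchy development). Values:
  `Minkowski.kretschmannAt_spacetime` (`= 0`: constant components, Prop. 3.41) and
  `Kerr.kretschmannAt_spacetime` (the closed form `48M² Re[(r + ia cos θ)⁶]/(r² + a²cos²θ)⁶` on
  `Kerr.spacetime M a r₀`, Visser arXiv:0706.0622 §3, given `hQ`).

## References

* B. O'Neill, *Semi-Riemannian geometry* (1983), Ch. 3, Lemma 3.35, Lemma 3.38, Prop. 3.41, Prop. 3.59, p. 90. [ONeill1983]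
* P. Topping, *Lectures on the Ricci flow* (2006), §3.2, (3.2.4) (`|Rm|²`). [Topping2006]
* M. Visser, *The Kerr spacetime: a brief introduction*, arXiv:0706.0622, §3 (Kretschmann scalar). [arXiv07060622]
* R. P. Kerr, A. Schild (1965), §3. [KerrSchild1965]
-/

noncomputable section

-- instance search through nested operator types (as in `CoordCurvature`)
set_option maxSynthPendingDepth 3

open Set Function Filter ContinuousLinearMap Metric
open scoped Topology Manifold ContDiff

namespace Literature.Geometry.Lorentzian

/-- Shortcut: the space of bilinear forms on `E4` is a normed group (canonical instance). [folklore] -/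
local instance instNormedAddCommGroupBilinE4K : NormedAddCommGroup (E4 →L[ℝ] E4 →L[ℝ] ℝ) :=
  ContinuousLinearMap.toNormedAddCommGroup

/-- Shortcut: the space of bilinear forms on `E4` is a normed space (canonical instance). [folklore] -/
local instance instNormedSpaceBilinE4K : NormedSpace ℝ (E4 →L[ℝ] E4 →L[ℝ] ℝ) :=
  ContinuousLinearMap.toNormedSpace

/-! ## Part E: Lipschitz dependence of `|Rm|²` on the jets; germ invariance; `Dθ` from `θ^* G` -/

namespace MetricCoord

section General

variable {E : Type*} [NormedAddCommGroup E] [NormedSpace ℝ E] [FiniteDimensional ℝ E]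

/-- **`|Rm|²` at `x` only depends on the germ of the components at `x`** (`g⁻¹(x)` depends on `G x`,
`R(x)` on the `2`-jet; `riemAt_congr_metric`). [folklore] -/
theorem rmNormSqAt_congr_metric {G G' : E → E →L[ℝ] E →L[ℝ] ℝ} {x : E} (h : G =ᶠ[𝓝 x] G') :
    rmNormSqAt G x = rmNormSqAt G' x := by
  have hg : ∀ i j, ginv G (Module.finBasis ℝ E) x i j = ginv G' (Module.finBasis ℝ E) x i j :=
    fun i j ↦ by simp only [ginv, sharpAt_congr_metric h.eq_of_nhds]
  rw [rmNormSqAt_eq_sum (Module.finBasis ℝ E), rmNormSqAt_eq_sum (Module.finBasis ℝ E)]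
  simp only [hg, riemAt_congr_metric h]

/-- **Nondegeneracy of pulled-back components forces an invertible differential**: if
`(θ^* G)(z) = G(θ z)(Dθ_z ·, Dθ_z ·)` is invertible then `Dθ_z` is injective, hence invertible
(finite dimension). O'Neill 1983, Ch. 3, p. 90. [cite: ONeill1983, Ch. 3, p. 90] -/
theorem isInvertible_fderiv_of_isInvertible_pullMetric {G : E → E →L[ℝ] E →L[ℝ] ℝ} {θ : E → E}
    {z : E} (h : (pullMetric G θ z).IsInvertible) : (fderiv ℝ θ z).IsInvertible := by
  refine KerrSchildChart.isInvertible_of_injective fun v w hvw ↦ ?_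
  obtain ⟨e, he⟩ := h
  have h0 : pullMetric G θ z (v - w) = 0 := by
    ext u
    rw [pullMetric_apply, map_sub, hvw, sub_self]
    simp
  have : e (v - w) = 0 := by rw [← ContinuousLinearEquiv.coe_coe, he, h0]
  exact sub_eq_zero.1 (e.map_eq_zero_iff.1 this)

omit [FiniteDimensional ℝ E] in
/-- **Bound on the curvature endomorphisms from a common jet bound**: `‖♯‖, ‖DG‖, ‖D²G‖ ≤ N`, `N ≥ 1`
give `‖R(X,Y)Z‖ ≤ 11 N⁴ ‖X‖‖Y‖‖Z‖` (`norm_riemAt_apply_le`: the constant there is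
`(15/2)‖♯‖²‖DG‖² + 3‖♯‖‖D²G‖ ≤ (21/2)N⁴`). [cite: ONeill1983, Ch. 3, Lemma 3.38] -/
theorem IsMetricOn.norm_riemAt_apply_le_of_jets [CompleteSpace E] {G : E → E →L[ℝ] E →L[ℝ] ℝ}
    {V : Set E} {x : E} (hG : IsMetricOn G V) (hx : x ∈ V) {N : ℝ} (hN : 1 ≤ N)
    (hs : ‖sharpAt G x‖ ≤ N) (h1 : ‖fderiv ℝ G x‖ ≤ N) (h2 : ‖fderiv ℝ (fderiv ℝ G) x‖ ≤ N)
    (X Y Z : E) : ‖riemAt G x X Y Z‖ ≤ 11 * N ^ 4 * ‖X‖ * ‖Y‖ * ‖Z‖ := by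
  have hN0 : 0 ≤ N := zero_le_one.trans hN
  have h := hG.norm_riemAt_apply_le hx X Y Z
  have hs0 : 0 ≤ ‖sharpAt G x‖ := norm_nonneg _
  have hd10 : 0 ≤ ‖fderiv ℝ G x‖ := ContinuousLinearMap.opNorm_nonneg _
  have hd20 : 0 ≤ ‖fderiv ℝ (fderiv ℝ G) x‖ := ContinuousLinearMap.opNorm_nonneg _
  have hsd : ‖sharpAt G x‖ ^ 2 * ‖fderiv ℝ G x‖ ^ 2 ≤ N ^ 4 := by
    calc ‖sharpAt G x‖ ^ 2 * ‖fderiv ℝ G x‖ ^ 2 ≤ N ^ 2 * N ^ 2 :=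
          mul_le_mul (pow_le_pow_left₀ hs0 hs 2) (pow_le_pow_left₀ hd10 h1 2) (by positivity)
            (by positivity)
      _ = N ^ 4 := by ring
  have hsd2 : ‖sharpAt G x‖ * ‖fderiv ℝ (fderiv ℝ G) x‖ ≤ N ^ 4 := by
    calc ‖sharpAt G x‖ * ‖fderiv ℝ (fderiv ℝ G) x‖ ≤ N * N := mul_le_mul hs h2 hd20 hN0
      _ = N ^ 2 := by ring
      _ ≤ N ^ 4 := pow_le_pow_right₀ hN (by norm_num)
  have hcoef : 2 * (2⁻¹ * (3 * (‖sharpAt G x‖ ^ 2 * ‖fderiv ℝ G x‖ ^ 2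
        + ‖sharpAt G x‖ * ‖fderiv ℝ (fderiv ℝ G) x‖)))
      + 2 * (2⁻¹ * (‖sharpAt G x‖ * (3 * ‖fderiv ℝ G x‖))) ^ 2 ≤ 11 * N ^ 4 := by
    have hN4 : 0 ≤ N ^ 4 := by positivity
    nlinarith
  have hXYZ : 0 ≤ ‖X‖ * ‖Y‖ * ‖Z‖ := by positivity
  calc ‖riemAt G x X Y Z‖ ≤ _ := h
    _ = (2 * (2⁻¹ * (3 * (‖sharpAt G x‖ ^ 2 * ‖fderiv ℝ G x‖ ^ 2
          + ‖sharpAt G x‖ * ‖fderiv ℝ (fderiv ℝ G) x‖)))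
          + 2 * (2⁻¹ * (‖sharpAt G x‖ * (3 * ‖fderiv ℝ G x‖))) ^ 2) * (‖X‖ * ‖Y‖ * ‖Z‖) := by ring
    _ ≤ 11 * N ^ 4 * (‖X‖ * ‖Y‖ * ‖Z‖) := mul_le_mul_of_nonneg_right hcoef hXYZ
    _ = 11 * N ^ 4 * ‖X‖ * ‖Y‖ * ‖Z‖ := by ring

end General

section Orthonormal

variable {E : Type*} [NormedAddCommGroup E] [InnerProductSpace ℝ E] [FiniteDimensional ℝ E]

/-- In an ORTHONORMAL basis a matrix coefficient of an operator `S : E* → E` is bounded by its norm: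
`|⟪e_i, S e^j⟫| ≤ ‖S‖`. [folklore] -/
theorem abs_coord_apply_coordCLM_le {ι : Type*} [Fintype ι] (e : OrthonormalBasis ι ℝ E)
    (S : (E →L[ℝ] ℝ) →L[ℝ] E) (i j : ι) :
    |e.toBasis.coord i (S (coordCLM e.toBasis j))| ≤ ‖S‖ := by
  rw [Module.Basis.coord_apply, OrthonormalBasis.coe_toBasis_repr_apply, e.repr_apply_apply]
  have hc : ‖coordCLM e.toBasis j‖ ≤ 1 := by
    refine ContinuousLinearMap.opNorm_le_bound _ zero_le_one fun w ↦ ?_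
    rw [coordCLM_apply, Module.Basis.coord_apply, OrthonormalBasis.coe_toBasis_repr_apply,
      e.repr_apply_apply, one_mul]
    simpa using abs_real_inner_le_norm (e j) w
  refine (abs_real_inner_le_norm _ _).trans ?_
  calc ‖e i‖ * ‖S (coordCLM e.toBasis j)‖ = ‖S (coordCLM e.toBasis j)‖ := by
        rw [e.orthonormal.1 i, one_mul]
    _ ≤ ‖S‖ * ‖coordCLM e.toBasis j‖ := le_opNorm _ _
    _ ≤ ‖S‖ * 1 := by gcongr
    _ = ‖S‖ := mul_one _

/-- `|tr(A ∘ B) − tr(A' ∘ B')| ≤ n (‖A‖ ‖B − B'‖ + ‖A − A'‖ ‖B'‖)` (`tr(AB) − tr(A'B') =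
tr(A(B − B')) + tr((A − A')B')`, `|tr T| ≤ n ‖T‖`). [folklore] -/
theorem abs_trace_comp_sub_le (A B A' B' : E →L[ℝ] E) :
    |traceCLM E (A.comp B) - traceCLM E (A'.comp B')| ≤
      Module.finrank ℝ E * (‖A‖ * ‖B - B'‖ + ‖A - A'‖ * ‖B'‖) := by
  have h : A.comp B - A'.comp B' = A.comp (B - B') + (A - A').comp B' := by
    rw [ContinuousLinearMap.comp_sub, ContinuousLinearMap.sub_comp]; abel
  rw [← map_sub, h, map_add, mul_add]
  refine (abs_add_le _ _).trans (add_le_add ?_ ?_)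
  · refine (abs_traceCLM_le_finrank_mul_norm _).trans ?_
    gcongr
    exact opNorm_comp_le _ _
  · refine (abs_traceCLM_le_finrank_mul_norm _).trans ?_
    gcongr
    exact opNorm_comp_le _ _

/-- The inverse-metric coefficients of two component fields in an orthonormal basis differ by at most
`‖♯ − ♯'‖`. [folklore] -/
theorem abs_ginv_sub_ginv_le {ι : Type*} [Fintype ι] (e : OrthonormalBasis ι ℝ E)
    (G G' : E → E →L[ℝ] E →L[ℝ] ℝ) (x : E) (i j : ι) :
    |ginv G e.toBasis x i j - ginv G' e.toBasis x i j| ≤ ‖sharpAt G x - sharpAt G' x‖ := by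
  have h : ginv G e.toBasis x i j - ginv G' e.toBasis x i j =
      e.toBasis.coord i ((sharpAt G x - sharpAt G' x) (coordCLM e.toBasis j)) := by
    simp only [ginv, sub_apply, map_sub]
  rw [h]
  exact abs_coord_apply_coordCLM_le e _ i j

/-- **Lipschitz dependence of `|Rm|²` on `(g⁻¹, R)`** in an orthonormal basis of an `n`-dimensional
space: if at `x` both fields have `‖♯‖ ≤ s`, `‖R(X,Y)Z‖ ≤ ρ‖X‖‖Y‖‖Z‖`, and differ by `‖♯ − ♯'‖ ≤ εₛ`,
`‖(R − R')(X,Y)Z‖ ≤ ε_ρ‖X‖‖Y‖‖Z‖`, then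
`| |Rm|²_G − |Rm|²_{G'} | ≤ n⁴ · n (2 s ρ² εₛ + 2 s² ρ ε_ρ)` (`rmNormSqAt_eq_sum`, term by term:
`uvw − u'v'w' = (u − u')vw + u'(v − v')w + u'v'(w − w')`). [cite: Topping2006, §3.2, (3.2.4)] -/
theorem abs_rmNormSqAt_sub_le {ι : Type*} [Fintype ι] (e : OrthonormalBasis ι ℝ E)
    {G G' : E → E →L[ℝ] E →L[ℝ] ℝ} {x : E} {ρ s εs ερ : ℝ} (hρ : 0 ≤ ρ) (hεs : 0 ≤ εs)
    (hερ : 0 ≤ ερ) (hs : ‖sharpAt G x‖ ≤ s) (hs' : ‖sharpAt G' x‖ ≤ s)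
    (hR : ∀ X Y Z : E, ‖riemAt G x X Y Z‖ ≤ ρ * ‖X‖ * ‖Y‖ * ‖Z‖)
    (hR' : ∀ X Y Z : E, ‖riemAt G' x X Y Z‖ ≤ ρ * ‖X‖ * ‖Y‖ * ‖Z‖)
    (hds : ‖sharpAt G x - sharpAt G' x‖ ≤ εs)
    (hdR : ∀ X Y Z : E, ‖riemAt G x X Y Z - riemAt G' x X Y Z‖ ≤ ερ * ‖X‖ * ‖Y‖ * ‖Z‖) :
    |rmNormSqAt G x - rmNormSqAt G' x| ≤
      (Fintype.card ι : ℝ) ^ 4 *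
        (Module.finrank ℝ E * (2 * s * ρ ^ 2 * εs + 2 * s ^ 2 * ρ * ερ)) := by
  have hs0 : 0 ≤ s := (norm_nonneg _).trans hs
  set b := e.toBasis with hb
  have hbe : ∀ a, b a = e a := fun a ↦ by rw [hb, OrthonormalBasis.coe_toBasis]
  have hRop : ∀ a c, ‖riemAt G x (b a) (b c)‖ ≤ ρ := fun a c ↦ by
    refine ContinuousLinearMap.opNorm_le_bound _ hρ fun Z ↦ ?_
    have h := hR (e a) (e c) Z
    rw [e.orthonormal.1 a, e.orthonormal.1 c, mul_one, mul_one] at h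
    rw [hbe, hbe]; exact h
  have hRop' : ∀ a c, ‖riemAt G' x (b a) (b c)‖ ≤ ρ := fun a c ↦ by
    refine ContinuousLinearMap.opNorm_le_bound _ hρ fun Z ↦ ?_
    have h := hR' (e a) (e c) Z
    rw [e.orthonormal.1 a, e.orthonormal.1 c, mul_one, mul_one] at h
    rw [hbe, hbe]; exact h
  have hdRop : ∀ a c, ‖riemAt G x (b a) (b c) - riemAt G' x (b a) (b c)‖ ≤ ερ := fun a c ↦ by
    refine ContinuousLinearMap.opNorm_le_bound _ hερ fun Z ↦ ?_
    have h := hdR (e a) (e c) Z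
    rw [e.orthonormal.1 a, e.orthonormal.1 c, mul_one, mul_one] at h
    rw [hbe, hbe, sub_apply]; exact h
  set n : ℝ := (Module.finrank ℝ E : ℝ) with hn
  have hn0 : 0 ≤ n := by rw [hn]; positivity
  have hterm : ∀ a a' c c',
      |ginv G b x a a' * ginv G b x c c' *
          traceCLM E ((riemAt G x (b a) (b c)).comp (riemAt G x (b a') (b c'))) -
        ginv G' b x a a' * ginv G' b x c c' *
          traceCLM E ((riemAt G' x (b a) (b c)).comp (riemAt G' x (b a') (b c')))| ≤
        n * (2 * s * ρ ^ 2 * εs + 2 * s ^ 2 * ρ * ερ) := by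
    intro a a' c c'
    have hu : |ginv G b x a a'| ≤ s := (abs_ginv_le_norm_sharpAt e G x a a').trans hs
    have hu' : |ginv G' b x a a'| ≤ s := (abs_ginv_le_norm_sharpAt e G' x a a').trans hs'
    have hv : |ginv G b x c c'| ≤ s := (abs_ginv_le_norm_sharpAt e G x c c').trans hs
    have hv' : |ginv G' b x c c'| ≤ s := (abs_ginv_le_norm_sharpAt e G' x c c').trans hs'
    have hdu : |ginv G b x a a' - ginv G' b x a a'| ≤ εs :=
      (abs_ginv_sub_ginv_le e G G' x a a').trans hds
    have hdv : |ginv G b x c c' - ginv G' b x c c'| ≤ εs :=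
      (abs_ginv_sub_ginv_le e G G' x c c').trans hds
    have hw : |traceCLM E ((riemAt G x (b a) (b c)).comp (riemAt G x (b a') (b c')))| ≤
        n * ρ ^ 2 := by
      refine (abs_traceCLM_le_finrank_mul_norm _).trans ?_
      rw [← hn]
      gcongr
      calc ‖(riemAt G x (b a) (b c)).comp (riemAt G x (b a') (b c'))‖
          ≤ ‖riemAt G x (b a) (b c)‖ * ‖riemAt G x (b a') (b c')‖ := opNorm_comp_le _ _
        _ ≤ ρ * ρ := mul_le_mul (hRop a c) (hRop a' c') (norm_nonneg _) hρ
        _ = ρ ^ 2 := (sq ρ).symm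
    have hdw : |traceCLM E ((riemAt G x (b a) (b c)).comp (riemAt G x (b a') (b c'))) -
        traceCLM E ((riemAt G' x (b a) (b c)).comp (riemAt G' x (b a') (b c')))| ≤
        n * (ρ * ερ + ερ * ρ) := by
      refine (abs_trace_comp_sub_le _ _ _ _).trans ?_
      rw [← hn]
      gcongr
      · exact hRop a c
      · exact hdRop a' c'
      · exact hdRop a c
      · exact hRop' a' c'
    -- `uvw − u'v'w' = (u − u')vw + u'(v − v')w + u'v'(w − w')`
    set u := ginv G b x a a'
    set u' := ginv G' b x a a'
    set v := ginv G b x c c'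
    set v' := ginv G' b x c c'
    set w := traceCLM E ((riemAt G x (b a) (b c)).comp (riemAt G x (b a') (b c')))
    set w' := traceCLM E ((riemAt G' x (b a) (b c)).comp (riemAt G' x (b a') (b c')))
    have hid : u * v * w - u' * v' * w' =
        (u - u') * v * w + u' * (v - v') * w + u' * v' * (w - w') := by ring
    rw [hid]
    have t1 : |(u - u') * v * w| ≤ εs * s * (n * ρ ^ 2) := by
      rw [abs_mul, abs_mul]
      exact mul_le_mul (mul_le_mul hdu hv (abs_nonneg _) hεs) hw (abs_nonneg _)
        (mul_nonneg hεs hs0)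
    have t2 : |u' * (v - v') * w| ≤ s * εs * (n * ρ ^ 2) := by
      rw [abs_mul, abs_mul]
      exact mul_le_mul (mul_le_mul hu' hdv (abs_nonneg _) hs0) hw (abs_nonneg _)
        (mul_nonneg hs0 hεs)
    have t3 : |u' * v' * (w - w')| ≤ s * s * (n * (ρ * ερ + ερ * ρ)) := by
      rw [abs_mul, abs_mul]
      exact mul_le_mul (mul_le_mul hu' hv' (abs_nonneg _) hs0) hdw (abs_nonneg _)
        (mul_nonneg hs0 hs0)
    calc |(u - u') * v * w + u' * (v - v') * w + u' * v' * (w - w')|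
        ≤ |(u - u') * v * w| + |u' * (v - v') * w| + |u' * v' * (w - w')| := abs_add_three _ _ _
      _ ≤ εs * s * (n * ρ ^ 2) + s * εs * (n * ρ ^ 2) + s * s * (n * (ρ * ερ + ερ * ρ)) :=
          add_le_add (add_le_add t1 t2) t3
      _ = n * (2 * s * ρ ^ 2 * εs + 2 * s ^ 2 * ρ * ερ) := by ring
  rw [rmNormSqAt_eq_sum b, rmNormSqAt_eq_sum b, neg_sub_neg, abs_sub_comm]
  simp only [← Finset.sum_sub_distrib]
  calc _ ≤ ∑ a, ∑ a', ∑ c, ∑ c', n * (2 * s * ρ ^ 2 * εs + 2 * s ^ 2 * ρ * ερ) := by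
        refine (Finset.abs_sum_le_sum_abs _ _).trans (Finset.sum_le_sum fun a _ ↦ ?_)
        refine (Finset.abs_sum_le_sum_abs _ _).trans (Finset.sum_le_sum fun a' _ ↦ ?_)
        refine (Finset.abs_sum_le_sum_abs _ _).trans (Finset.sum_le_sum fun c _ ↦ ?_)
        exact (Finset.abs_sum_le_sum_abs _ _).trans (Finset.sum_le_sum fun c' _ ↦ hterm a a' c c')
    _ = (Fintype.card ι : ℝ) ^ 4 * (n * (2 * s * ρ ^ 2 * εs + 2 * s ^ 2 * ρ * ερ)) := by
        simp only [Finset.sum_const, Finset.card_univ, nsmul_eq_mul]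
        ring

end Orthonormal

end MetricCoord

/-! ## Part F: the Kretschmann scalar of a spacetime at a point; chart independence -/

namespace Spacetime

variable (𝓢 : Spacetime 4)

/-- **The Kretschmann scalar `|Rm|² = R_{abcd}R^{abcd}` of a spacetime at a point**, read in the
preferred chart: `rmNormSqAt` (Topping's `|Rm|²`, `CoordCurvatureNormSq.lean`) of the components
`(c⁻¹)^* g`, `c = chartAt E4 p`, at `c p`. It does not depend on the chart
(`rmNormSqAt_metricInCoords_eq_kretschmannAt`: any smooth local parametrisation with nondegenerate
components computes it). Visser arXiv:0706.0622, §3 (the Kretschmann scalar of Kerr);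
O'Neill 1983, Ch. 3, Lemma 3.35 ff. [cite: arXiv07060622, §3] -/
def kretschmannAt (p : 𝓢.carrier) : ℝ :=
  MetricCoord.rmNormSqAt (𝓢.metricInCoords (chartAt E4 p).symm) (chartAt E4 p p)

/-- The components of the metric in a preferred chart are nondegenerate at the coordinate image of
every point of the chart source (`d(c)` is onto and `g` is nondegenerate). [cite: ONeill1983, Ch. 3, p. 90] -/
theorem metricInCoords_chartAt_symm_nondegenerate {p z : 𝓢.carrier}
    (hz : z ∈ (chartAt E4 p).source) (v : E4)
    (hv : ∀ w : E4, 𝓢.metricInCoords (chartAt E4 p).symm (chartAt E4 p z) v w = 0) : v = 0 := by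
  have hsurj := (mdifferentiable_chart (I := 𝓡 4) p).mfderiv_surjective hz
  obtain ⟨u, rfl⟩ := hsurj v
  have hu0 : u = 0 := by
    refine 𝓢.metric.nondegenerate z u fun u' ↦ ?_
    have h := 𝓢.metricInCoords_chartAt_symm_apply_mfderiv hz u u'
    exact h.symm.trans (hv _)
  rw [hu0, map_zero]
  rfl

/-- **The components of the metric in a preferred chart are metric components on the chart target**
(smooth, symmetric, nondegenerate: `IsMetricOn`). [cite: ONeill1983, Ch. 3, Lemma 3.35] -/
theorem isMetricOn_metricInCoords_chartAt_symm (p : 𝓢.carrier) :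
    MetricCoord.IsMetricOn (𝓢.metricInCoords (chartAt E4 p).symm) (chartAt E4 p).target where
  isOpen := (chartAt E4 p).open_target
  contDiffOn := 𝓢.contDiffOn_metricInCoords_chartAt_symm p
  symm y _ v w := 𝓢.metricInCoords_symm _ y v w
  isInvertible y hy := by
    refine MetricCoord.isInvertible_of_nondegenerate fun v hv ↦ ?_
    have hz : (chartAt E4 p).symm y ∈ (chartAt E4 p).source := (chartAt E4 p).map_target hy
    have hy' : chartAt E4 p ((chartAt E4 p).symm y) = y := (chartAt E4 p).right_inv hy
    refine 𝓢.metricInCoords_chartAt_symm_nondegenerate hz v fun w ↦ ?_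
    rw [hy']
    exact hv w

/-- **Chart independence of the Kretschmann scalar.** For a parametrisation `ψ : E4 → 𝓢`, smooth on
an open `O ∋ y`, whose components `ψ^* g` are nondegenerate at `y`, `|Rm|²` of the components at `y`
IS the Kretschmann scalar of `𝓢` at `ψ y`: near `y`, `ψ^* g = θ^*[(c⁻¹)^* g]` for the change of
coordinates `θ = c ∘ ψ` (a local diffeomorphism: nondegenerate components force `Dθ` invertible), and
`|Rm|²` is natural (`rmNormSqAt_pullMetric`). [cite: ONeill1983, Ch. 3, Prop. 3.59] -/
theorem rmNormSqAt_metricInCoords_eq_kretschmannAt {ψ : E4 → 𝓢.carrier} {O : Set E4}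
    (hO : IsOpen O) (hψ : ContMDiffOn 𝓘(ℝ, E4) (𝓡 4) ∞ ψ O) {y : E4} (hy : y ∈ O)
    (hnd : (𝓢.metricInCoords ψ y).IsInvertible) :
    MetricCoord.rmNormSqAt (𝓢.metricInCoords ψ) y = 𝓢.kretschmannAt (ψ y) := by
  set p := ψ y with hp
  set c := chartAt E4 p with hc
  set θ : E4 → E4 := c ∘ ψ with hθ
  set GS := 𝓢.metricInCoords c.symm with hGS
  set F := 𝓢.metricInCoords ψ with hF
  -- the open set where `ψ` maps into the chart source
  set W₁ : Set E4 := O ∩ ψ ⁻¹' c.source with hW₁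
  have hW₁ : IsOpen W₁ := hψ.continuousOn.isOpen_inter_preimage hO c.open_source
  have hyW₁ : y ∈ W₁ := ⟨hy, mem_chart_source E4 p⟩
  -- `θ` is smooth on `W₁`, `F` on `O`
  have hθsm : ContDiffOn ℝ ∞ θ W₁ := by
    rw [← contMDiffOn_iff_contDiffOn]
    exact (contMDiffOn_chart (x := p)).comp (hψ.mono inter_subset_left) fun z hz ↦ hz.2
  have hFsm : ContDiffOn ℝ ∞ F O := 𝓢.contDiffOn_metricInCoords hO hψ
  -- on `W₁`, `F` is the pull-back of the chart components along `θ`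
  have hFθ : ∀ z ∈ W₁, F z = MetricCoord.pullMetric GS θ z := by
    intro z hz
    have hev : ψ =ᶠ[𝓝 z] c.symm ∘ θ := by
      filter_upwards [hW₁.mem_nhds hz] with z' hz'
      exact (c.left_inv hz'.2).symm
    have hψ' : MDifferentiableAt 𝓘(ℝ, E4) (𝓡 4) c.symm (θ z) :=
      mdifferentiableAt_atlas_symm (chart_mem_atlas E4 p) (c.map_source hz.2)
    have hθz : DifferentiableAt ℝ θ z :=
      (hθsm.contDiffAt (hW₁.mem_nhds hz)).differentiableAt (by simp)
    rw [hF, 𝓢.metricInCoords_eq_bilinPullback_of_eventuallyEq hev hψ' hθz]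
    ext v w
    rfl
  -- the smaller open set where moreover `F` is nondegenerate
  set W : Set E4 := W₁ ∩ F ⁻¹' {T | T.IsInvertible} with hW
  have hWo : IsOpen W :=
    (hFsm.continuousOn.mono inter_subset_left).isOpen_inter_preimage hW₁
      KerrWindow.isOpen_setOf_isInvertible
  have hyW : y ∈ W := ⟨hyW₁, hnd⟩
  -- `θ` is a change of coordinates on `W`
  have hcc : MetricCoord.IsCoordChangeOn θ W c.target :=
    { isOpen := hWo
      contDiffOn := hθsm.mono inter_subset_left
      mapsTo := fun z hz ↦ c.map_source hz.1.2
      isInvertible := fun z hz ↦ by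
        have h : (MetricCoord.pullMetric GS θ z).IsInvertible := by
          rw [← hFθ z hz.1]; exact hz.2
        exact MetricCoord.isInvertible_fderiv_of_isInvertible_pullMetric h }
  -- naturality
  have hgerm : F =ᶠ[𝓝 y] MetricCoord.pullMetric GS θ := by
    filter_upwards [hW₁.mem_nhds hyW₁] with z hz using hFθ z hz
  rw [MetricCoord.rmNormSqAt_congr_metric hgerm,
    KerrWindow.rmNormSqAt_pullMetric (𝓢.isMetricOn_metricInCoords_chartAt_symm p) hcc hyW]
  rfl

/-- **Invariance of the Kretschmann scalar under isometric immersions between spacetimes** (e.g. the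
embedding of a Cauchy development into a larger one, `CauchyDevelopment.EmbedsInto`):
`kretschmannAt 𝓢 (E x) = kretschmannAt 𝓤 x` — read `𝓢` through the parametrisation `E ∘ (chartAt E4 x)⁻¹`,
whose components ARE the chart components of `𝓤` (`E^* g_𝓢 = g_𝓤`), and use chart independence.
[cite: ONeill1983, Ch. 3, pp. 90–91] -/
theorem kretschmannAt_comp_of_isIsometricImmersion {𝓤 : Spacetime 4} {E : 𝓤.carrier → 𝓢.carrier}
    (hE : 𝓤.metric.IsIsometricImmersion 𝓢.metric.toPseudoRiemannianMetric E) (x : 𝓤.carrier) :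
    𝓢.kretschmannAt (E x) = 𝓤.kretschmannAt x := by
  set c := chartAt E4 x with hc
  set ψ : E4 → 𝓢.carrier := E ∘ c.symm with hψdef
  have hO : IsOpen c.target := c.open_target
  have hy : c x ∈ c.target := c.map_source (mem_chart_source E4 x)
  have hψ : ContMDiffOn 𝓘(ℝ, E4) (𝓡 4) ∞ ψ c.target :=
    hE.1.comp_contMDiffOn (contMDiffOn_chart_symm (x := x))
  -- the components of `ψ` are the chart components of `𝓤`
  have hcomp : ∀ z ∈ c.target, 𝓢.metricInCoords ψ z = 𝓤.metricInCoords c.symm z := by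
    intro z hz
    have hcs : MDifferentiableAt 𝓘(ℝ, E4) (𝓡 4) c.symm z :=
      mdifferentiableAt_atlas_symm (chart_mem_atlas E4 x) hz
    have hEd : MDifferentiableAt (𝓡 4) (𝓡 4) E (c.symm z) :=
      (hE.1 (c.symm z)).mdifferentiableAt (by simp)
    have hchain : mfderiv 𝓘(ℝ, E4) (𝓡 4) ψ z =
        (mfderiv (𝓡 4) (𝓡 4) E (c.symm z)).comp (mfderiv 𝓘(ℝ, E4) (𝓡 4) c.symm z) :=
      mfderiv_comp z hEd hcs
    ext v w
    rw [metricInCoords_apply, metricInCoords_apply, hchain]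
    exact DFunLike.congr_fun (DFunLike.congr_fun (hE.2 (c.symm z)) _) _
  have hnd : (𝓢.metricInCoords ψ (c x)).IsInvertible := by
    rw [hcomp _ hy]; exact (𝓤.isMetricOn_metricInCoords_chartAt_symm x).isInvertible _ hy
  have h1 := 𝓢.rmNormSqAt_metricInCoords_eq_kretschmannAt hO hψ hy hnd
  have hψx : ψ (c x) = E x := by
    show E (c.symm (c x)) = E x
    rw [c.left_inv (mem_chart_source E4 x)]
  rw [hψx] at h1
  rw [← h1]
  have hgerm : 𝓢.metricInCoords ψ =ᶠ[𝓝 (c x)] 𝓤.metricInCoords c.symm := by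
    filter_upwards [hO.mem_nhds hy] with z hz using hcomp z hz
  rw [MetricCoord.rmNormSqAt_congr_metric hgerm]
  rfl

end Spacetime

/-- **The Kretschmann scalar of Minkowski spacetime vanishes** (its components in the identity chart
are the constant `η`, whose curvature endomorphisms vanish: O'Neill 1983, Ch. 3, Prop. 3.41,
"semi-Euclidean space is flat"). [cite: ONeill1983, Ch. 3, Prop. 3.41] -/
theorem Minkowski.kretschmannAt_spacetime (q : Minkowski.spacetime.carrier) :
    Minkowski.spacetime.kretschmannAt q = 0 := by
  have hψ : ∀ z : E4, (chartAt E4 q).symm z = z := fun z ↦ rfl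
  have hG : Minkowski.spacetime.metricInCoords (chartAt E4 q).symm = fun _ ↦ Minkowski.bilin := by
    funext y
    have hfun : (⇑(chartAt E4 q).symm : E4 → Minkowski.spacetime.carrier) = id := funext hψ
    have hd : ∀ u : E4, mfderiv 𝓘(ℝ, E4) (𝓡 4)
        (⇑(chartAt E4 q).symm : E4 → Minkowski.spacetime.carrier) y u = u := fun u ↦ by
      rw [hfun]
      exact congrArg (fun L : E4 →L[ℝ] E4 ↦ L u) (mfderiv_id (I := 𝓘(ℝ, E4)) (x := y))
    ext v w
    rw [Spacetime.metricInCoords_apply, hd v, hd w]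
    rfl
  unfold Spacetime.kretschmannAt
  rw [hG]
  have h := MetricCoord.abs_rmNormSqAt_le_of_riemAt_le (EuclideanSpace.basisFun (Fin 4) ℝ)
    (G := fun _ : E4 ↦ Minkowski.bilin) (x := chartAt E4 q q) (ρ := 0) le_rfl le_rfl
    fun X Y Z ↦ by rw [MetricCoord.riemAt_const]; simp
  have h0 : |MetricCoord.rmNormSqAt (fun _ : E4 ↦ Minkowski.bilin) (chartAt E4 q q)| ≤ 0 := by
    simpa using h
  exact abs_nonpos_iff.1 h0


/-- The components of the Kerr spacetime `Kerr.spacetime M a r₀` in its (inclusion) chart are the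
Kerr–Schild components `g_{M,a}` on the chart domain `Kerr.region a r₀`. [cite: KerrSchild1965, §3] -/
theorem Kerr.metricInCoords_spacetime_chartAt_symm [Kerr.Facts] (M a r₀ : ℝ) (hM : 0 ≤ M)
    (x : (Kerr.spacetime M a r₀ hM).carrier) {y : E4} (hy : y ∈ (Kerr.region a r₀ : Set E4)) :
    (Kerr.spacetime M a r₀ hM).metricInCoords (chartAt E4 x).symm y = Kerr.bilin M a y := by
  have hd : ∀ u : E4, mfderiv 𝓘(ℝ, E4) (𝓡 4)
      (⇑(chartAt E4 x).symm : E4 → (Kerr.spacetime M a r₀ hM).carrier) y u = u := fun u ↦ by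
    have h := OpensChart.mfderiv_extChartAt_symm_apply (U := Kerr.region a r₀) x hy u
    rw [OpensChart.extChartAt_eq] at h
    exact h
  have hval : ((chartAt E4 x).symm y).1 = y := OpensChart.chartAt_symm_val (U := Kerr.region a r₀) x hy
  ext v w
  rw [Spacetime.metricInCoords_apply, hd v, hd w]
  change Kerr.bilin M a ((chartAt E4 x).symm y).1 v w = Kerr.bilin M a y v w
  rw [hval]

/-- **The Kretschmann scalar of the Kerr spacetime** `Kerr.spacetime M a r₀` at a point is the closed
form `48 M² Re[(r + i a cos θ)⁶]/(r² + a² cos² θ)⁶`, `a cos θ = a x₃/r` — given the named fact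
`Kerr.kretschmannScalar_closedForm` (hypothesis `hQ`; `kretschmannAt` is read in the inclusion chart,
where the components are `g_{M,a}`). [cite: arXiv07060622, §3] -/
theorem Kerr.kretschmannAt_spacetime [Kerr.Facts]
    (hQ : Kerr.kretschmannScalar_closedForm)
    (M a r₀ : ℝ) (hM : 0 ≤ M) (x : (Kerr.spacetime M a r₀ hM).carrier) :
    (Kerr.spacetime M a r₀ hM).kretschmannAt x =
      48 * M ^ 2 * (((Kerr.radius a x.1 : ℂ) +
        ((a * (x.1 3 / Kerr.radius a x.1) : ℝ) : ℂ) * Complex.I) ^ 6).re /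
        (Kerr.radius a x.1 ^ 2 + (a * (x.1 3 / Kerr.radius a x.1)) ^ 2) ^ 6 := by
  unfold Spacetime.kretschmannAt
  have hG : (Kerr.spacetime M a r₀ hM).metricInCoords (chartAt E4 x).symm =ᶠ[𝓝 (chartAt E4 x x)]
      Kerr.bilin M a := by
    filter_upwards [(Kerr.region a r₀).2.mem_nhds
      (show (chartAt E4 x x : E4) ∈ (Kerr.region a r₀ : Set E4) from x.2)] with y hy
    exact Kerr.metricInCoords_spacetime_chartAt_symm M a r₀ hM x hy
  rw [MetricCoord.rmNormSqAt_congr_metric hG]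
  exact hQ M a x.1 (Kerr.radius_pos_of_mem_region x.2)


end Literature.Geometry.Lorentzian

end
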